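import Summits.CriticalPhenomena.SAWScalingLimit.Theses.SAWTotalPositivity
import Literature.Probability.Percolation.FourArmGarbanSquareDomain

/-!
# Rectangular lattice domains at mesh `1` and a proved-complete path enumerator

Infrastructure for the negative-lane files of crux `EdgeOfPositivity` (stmt-CriticalPhenomena-11344,
route SAWTotalPositivity; refuter `cdisprove`): the open rectangle
`(-1/2, a+1/2) × (-1/2, b+1/2)` has discrete domain the grid `{0..a} × {0..b}` (one component,
lattice adjacency; bounded, convex hence simply connected), and `allPaths` is a structurally
recursive DFS, evaluated by the kernel with `decide`, that is COMPLETE: every repetition-free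
vertex list following given neighbour lists is produced (`mem_allPaths`), so the support of every
SAW of a small domain lies in an explicit, kernel-computed list (`follows_support_tail`).
-/

noncomputable section

open MeasureTheory Filter Topology Set Function
open Literature.Probability.LatticeModels Literature.Probability.Percolation
open Literature.Probability.RandomPlanarGeometry Literature.Probability.RandomPlanarGeometry.SAW
open scoped ENNReal NNReal

namespace Summit.CriticalPhenomena.SAWScalingLimit.Theorems.EdgeOfPositivity.Negative


/-! ### §2a Rectangular lattice domains at mesh 1 -/

/-- The open rectangle `(-1/2, a + 1/2) × (-1/2, b + 1/2)`, whose lattice points at mesh `1` are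
`{0,…,a} × {0,…,b}`. [folklore] -/
def rectDomain (a b : ℕ) : Set ℂ :=
  Set.Ioo (-(1 / 2 : ℝ)) (a + 1 / 2) ×ℂ Set.Ioo (-(1 / 2 : ℝ)) (b + 1 / 2)

/-- The sites `{0,…,a} × {0,…,b}`. [folklore] -/
def rectSites (a b : ℕ) : Set (Site 2) :=
  {v | (0 ≤ v 0 ∧ v 0 ≤ a) ∧ (0 ≤ v 1 ∧ v 1 ≤ b)}

/-- Membership in `rectSites`, unfolded. [folklore] -/
@[simp] theorem mem_rectSites_iff {a b : ℕ} {v : Site 2} :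
    v ∈ rectSites a b ↔ (0 ≤ v 0 ∧ v 0 ≤ a) ∧ (0 ≤ v 1 ∧ v 1 ≤ b) := Iff.rfl

/-- The mesh vertices of the rectangle at mesh `1` are `{0,…,a} × {0,…,b}`. [folklore] -/
theorem meshVertices_rectDomain (a b : ℕ) : meshVertices (rectDomain a b) 1 = rectSites a b := by
  ext v
  rw [mem_meshVertices_iff, rectDomain, Complex.mem_reProdIm, meshPoint_re, meshPoint_im, one_mul,
    one_mul, int_mem_Ioo_half_iff, int_mem_Ioo_half_iff, mem_rectSites_iff]

/-- The rectangle is convex. [folklore] -/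
theorem convex_rectDomain (a b : ℕ) : Convex ℝ (rectDomain a b) :=
  ((convex_Ioo _ _).linear_preimage Complex.reLm).inter ((convex_Ioo _ _).linear_preimage Complex.imLm)

/-- The rectangle is bounded. [folklore] -/
theorem isBounded_rectDomain (a b : ℕ) : Bornology.IsBounded (rectDomain a b) := by
  refine (Metric.isBounded_closedBall (x := (0 : ℂ)) (r := 2 * ((a : ℝ) + b + 1))).subset ?_
  intro z hz
  rw [rectDomain, Complex.mem_reProdIm, Set.mem_Ioo, Set.mem_Ioo] at hz
  rw [Metric.mem_closedBall, dist_zero_right]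
  have ha : (0 : ℝ) ≤ a := Nat.cast_nonneg a
  have hb : (0 : ℝ) ≤ b := Nat.cast_nonneg b
  have hre : |z.re| ≤ (a : ℝ) + b + 1 := abs_le.2 ⟨by linarith [hz.1.1], by linarith [hz.1.2]⟩
  have him : |z.im| ≤ (a : ℝ) + b + 1 := abs_le.2 ⟨by linarith [hz.2.1], by linarith [hz.2.2]⟩
  calc ‖z‖ ≤ |z.re| + |z.im| := Complex.norm_le_abs_re_add_abs_im z
    _ ≤ 2 * ((a : ℝ) + b + 1) := by linarith

/-- The rectangle is nonempty (it contains `0`). [folklore] -/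
theorem zero_mem_rectDomain (a b : ℕ) : (0 : ℂ) ∈ rectDomain a b := by
  rw [rectDomain, Complex.mem_reProdIm, Set.mem_Ioo, Set.mem_Ioo, Complex.zero_re, Complex.zero_im]
  have ha : (0 : ℝ) ≤ a := Nat.cast_nonneg a
  have hb : (0 : ℝ) ≤ b := Nat.cast_nonneg b
  refine ⟨⟨by norm_num, by linarith⟩, by norm_num, by linarith⟩

/-- The rectangle is simply connected (convex and nonempty, hence contractible). [folklore] -/
theorem simplyConnectedSpace_rectDomain (a b : ℕ) : SimplyConnectedSpace (rectDomain a b) := by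
  haveI := (convex_rectDomain a b).contractibleSpace ⟨0, zero_mem_rectDomain a b⟩
  exact SimplyConnectedSpace.ofContractible _

/-- Lattice neighbours inside the rectangle are mesh-adjacent (the unit segment joining them stays
in the convex rectangle). [folklore] -/
theorem meshGraph_adj_of_mem_rectSites {a b : ℕ} {x y : Site 2} (hx : x ∈ rectSites a b)
    (hy : y ∈ rectSites a b) (hxy : (zdGraph 2).Adj x y) : (meshGraph (rectDomain a b) 1).Adj x y := by
  refine meshGraph_adj_iff.2 ⟨hxy, ?_⟩
  have hx' : meshPoint 1 x ∈ rectDomain a b := by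
    rw [← mem_meshVertices_iff, meshVertices_rectDomain]; exact hx
  have hy' : meshPoint 1 y ∈ rectDomain a b := by
    rw [← mem_meshVertices_iff, meshVertices_rectDomain]; exact hy
  exact ((convex_rectDomain a b).segment_subset hx' hy').trans subset_closure

/-- The site `(i, j)`. [folklore] -/
def st (i j : ℤ) : Site 2 := ![i, j]

/-- First coordinate of `st`. [folklore] -/
@[simp] theorem st_zero (i j : ℤ) : st i j 0 = i := rfl

/-- Second coordinate of `st`. [folklore] -/
@[simp] theorem st_one (i j : ℤ) : st i j 1 = j := rfl

/-- Every site is `st (v 0) (v 1)`. [folklore] -/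
theorem st_eta (v : Site 2) : st (v 0) (v 1) = v := by
  ext k; fin_cases k <;> rfl

/-- `(i+1, j)` is a lattice neighbour of `(i, j)`. [folklore] -/
theorem zdGraph_adj_st_succ_left (i j : ℤ) : (zdGraph 2).Adj (st i j) (st (i + 1) j) := by
  rw [zdGraph_adj_iff]
  refine ⟨0, Or.inl ?_⟩
  ext k; fin_cases k <;> simp [st]

/-- `(i, j+1)` is a lattice neighbour of `(i, j)`. [folklore] -/
theorem zdGraph_adj_st_succ_right (i j : ℤ) : (zdGraph 2).Adj (st i j) (st i (j + 1)) := by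
  rw [zdGraph_adj_iff]
  refine ⟨1, Or.inl ?_⟩
  ext k; fin_cases k <;> simp [st]

/-- The mesh graph of the rectangle is connected: every site is joined to the corner `(0,0)` along
the bottom row and then up its column. [folklore] -/
theorem meshVertexGraph_rectDomain_preconnected (a b : ℕ) :
    (meshVertexGraph (rectDomain a b) 1).Preconnected := by
  have hV : meshVertices (rectDomain a b) 1 = rectSites a b := meshVertices_rectDomain a b
  set G := meshVertexGraph (rectDomain a b) 1 with hG
  have h00 : st 0 0 ∈ meshVertices (rectDomain a b) 1 := by
    rw [hV, mem_rectSites_iff]; simp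
  have hrow : ∀ k : ℕ, k ≤ a →
      ∃ h : st k 0 ∈ meshVertices (rectDomain a b) 1, G.Reachable ⟨st 0 0, h00⟩ ⟨st k 0, h⟩ := by
    intro k hk
    induction k with
    | zero => exact ⟨by exact_mod_cast h00, by exact_mod_cast SimpleGraph.Reachable.refl _⟩
    | succ k ih =>
      obtain ⟨hk', hr⟩ := ih (Nat.le_of_succ_le hk)
      have hmem : st (k + 1 : ℕ) 0 ∈ meshVertices (rectDomain a b) 1 := by
        rw [hV, mem_rectSites_iff]; simp; omega
      refine ⟨hmem, hr.trans (SimpleGraph.Adj.reachable ?_)⟩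
      simp only [hG, SimpleGraph.comap_adj, Function.Embedding.coe_subtype]
      refine meshGraph_adj_of_mem_rectSites (hV ▸ hk') (hV ▸ hmem) ?_
      have := zdGraph_adj_st_succ_left k 0
      push_cast at this ⊢; exact this
  have hcol : ∀ (i k : ℕ), i ≤ a → k ≤ b →
      ∃ h : st i k ∈ meshVertices (rectDomain a b) 1, G.Reachable ⟨st 0 0, h00⟩ ⟨st i k, h⟩ := by
    intro i k hi hk
    induction k with
    | zero => obtain ⟨h, hr⟩ := hrow i hi; exact ⟨by exact_mod_cast h, by exact_mod_cast hr⟩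
    | succ k ih =>
      obtain ⟨hk', hr⟩ := ih (Nat.le_of_succ_le hk)
      have hmem : st i (k + 1 : ℕ) ∈ meshVertices (rectDomain a b) 1 := by
        rw [hV, mem_rectSites_iff]; simp; omega
      refine ⟨hmem, hr.trans (SimpleGraph.Adj.reachable ?_)⟩
      simp only [hG, SimpleGraph.comap_adj, Function.Embedding.coe_subtype]
      refine meshGraph_adj_of_mem_rectSites (hV ▸ hk') (hV ▸ hmem) ?_
      have := zdGraph_adj_st_succ_right i k
      push_cast at this ⊢; exact this
  have hreach : ∀ v : meshVertices (rectDomain a b) 1, G.Reachable ⟨st 0 0, h00⟩ v := by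
    rintro ⟨v, hv⟩
    have hv' := hv
    rw [hV, mem_rectSites_iff] at hv'
    obtain ⟨i, hi⟩ : ∃ i : ℕ, (i : ℤ) = v 0 := ⟨(v 0).toNat, Int.toNat_of_nonneg hv'.1.1⟩
    obtain ⟨k, hk⟩ : ∃ k : ℕ, (k : ℤ) = v 1 := ⟨(v 1).toNat, Int.toNat_of_nonneg hv'.2.1⟩
    have hia : i ≤ a := by have := hv'.1.2; omega
    have hkb : k ≤ b := by have := hv'.2.2; omega
    obtain ⟨h, hr⟩ := hcol i k hia hkb
    have heq : st i k = v := by rw [hi, hk, st_eta]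
    have hsub : (⟨v, hv⟩ : meshVertices (rectDomain a b) 1) = ⟨st i k, h⟩ := Subtype.ext heq.symm
    rw [hsub]; exact hr
  exact fun u v => (hreach u).symm.trans (hreach v)

/-- The discrete domain of the rectangle is the whole grid `{0,…,a} × {0,…,b}` (one component;
the "largest component" convention is harmless here). [folklore] -/
theorem meshDomain_rectDomain (a b : ℕ) : meshDomain (rectDomain a b) 1 = rectSites a b := by
  rw [meshDomain_eq_meshVertices_of_preconnected (meshVertexGraph_rectDomain_preconnected a b),
    meshVertices_rectDomain]

/-- Adjacency in `R_1` is lattice adjacency between sites of the grid. [folklore] -/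
theorem adj_rect_iff {a b : ℕ} {x y : Site 2} :
    (discreteDomainGraph (rectDomain a b) 1).Adj x y ↔
      (zdGraph 2).Adj x y ∧ x ∈ rectSites a b ∧ y ∈ rectSites a b := by
  rw [discreteDomainGraph_adj_iff, meshDomain_rectDomain]
  constructor
  · rintro ⟨h, hx, hy⟩; exact ⟨(meshGraph_adj_iff.1 h).1, hx, hy⟩
  · rintro ⟨h, hx, hy⟩; exact ⟨meshGraph_adj_of_mem_rectSites hx hy h, hx, hy⟩

/-- Every vertex of a walk of `R_1` issued from a grid site lies in the grid. [folklore] -/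
theorem support_subset_rectSites {a b : ℕ} {u v : Site 2} (hu : u ∈ rectSites a b)
    (p : (discreteDomainGraph (rectDomain a b) 1).Walk u v) : ∀ w ∈ p.support, w ∈ rectSites a b := by
  induction p with
  | nil => intro w hw; rw [SimpleGraph.Walk.support_nil, List.mem_singleton] at hw; exact hw ▸ hu
  | cons h q ih =>
    intro w hw
    rw [SimpleGraph.Walk.support_cons, List.mem_cons] at hw
    rcases hw with rfl | hw
    · exact hu
    · exact ih (adj_rect_iff.1 h).2.2 w hw

/-! ### §2b A proved-complete DFS enumerator of simple paths (kernel-evaluable) -/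

section DFS
variable {α : Type*} [DecidableEq α]

/-- All vertex lists `cur :: rest` that follow the neighbour lists `nbr`, avoid `vis` and repeat
no vertex, END at `tgt` and stop there, with `rest.length ≤ fuel`. Structural recursion on the
fuel, so the kernel evaluates it by `decide`. [folklore] -/
def allPaths (nbr : α → List α) (tgt : α) : ℕ → α → List α → List (List α)
  | 0, cur, _ => if cur = tgt then [[cur]] else []
  | fuel + 1, cur, vis =>
    if cur = tgt then [[cur]]
    else ((nbr cur).filter fun w => w ∉ vis ∧ w ≠ cur).flatMap
      fun w => (allPaths nbr tgt fuel w (cur :: vis)).map (cur :: ·)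

/-- `rest` follows the neighbour lists starting from `cur`. [folklore] -/
def Follows (nbr : α → List α) : α → List α → Prop
  | _, [] => True
  | cur, w :: rest => w ∈ nbr cur ∧ Follows nbr w rest

/-- **Completeness of the enumerator.** Every repetition-free list `cur :: rest` following `nbr`,
avoiding `vis` after its head, ending at `tgt`, of length `≤ fuel + 1`, is produced by
`allPaths nbr tgt fuel cur vis`. [folklore] -/
theorem mem_allPaths (nbr : α → List α) (tgt : α) :
    ∀ (fuel : ℕ) (cur : α) (vis rest : List α),
      Follows nbr cur rest → (cur :: rest).Nodup → (∀ w ∈ rest, w ∉ vis) →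
      (cur :: rest).getLast (List.cons_ne_nil _ _) = tgt → rest.length ≤ fuel →
      cur :: rest ∈ allPaths nbr tgt fuel cur vis := by
  intro fuel
  induction fuel with
  | zero =>
    intro cur vis rest _ _ _ hlast hlen
    obtain rfl : rest = [] := List.eq_nil_of_length_eq_zero (Nat.le_zero.1 hlen)
    simp only [List.getLast_singleton] at hlast
    simp [allPaths, hlast]
  | succ fuel ih =>
    intro cur vis rest hf hnd hvis hlast hlen
    cases rest with
    | nil =>
      simp only [List.getLast_singleton] at hlast
      simp [allPaths, hlast]
    | cons w rest' =>
      -- `cur ≠ tgt`: `tgt` is the last element of `w :: rest'`, and `cur ∉ w :: rest'`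
      have hcur : cur ∉ w :: rest' := (List.nodup_cons.1 hnd).1
      have htgt_mem : tgt ∈ w :: rest' := by
        have : (cur :: w :: rest').getLast (List.cons_ne_nil _ _) =
            (w :: rest').getLast (List.cons_ne_nil _ _) := List.getLast_cons (List.cons_ne_nil _ _)
        rw [this] at hlast
        exact hlast ▸ List.getLast_mem _
      have hne : cur ≠ tgt := fun h => hcur (h ▸ htgt_mem)
      rw [allPaths, if_neg hne, List.mem_flatMap]
      refine ⟨w, ?_, ?_⟩
      · rw [List.mem_filter]
        refine ⟨hf.1, ?_⟩
        simp only [decide_eq_true_eq]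
        exact ⟨hvis w List.mem_cons_self, fun h => hcur (h ▸ List.mem_cons_self)⟩
      · rw [List.mem_map]
        refine ⟨w :: rest', ?_, rfl⟩
        apply ih
        · exact hf.2
        · exact (List.nodup_cons.1 hnd).2
        · intro u hu
          rw [List.mem_cons, not_or]
          refine ⟨?_, hvis u (List.mem_cons_of_mem _ hu)⟩
          rintro rfl
          exact hcur (List.mem_cons_of_mem _ hu)
        · have : (cur :: w :: rest').getLast (List.cons_ne_nil _ _) =
              (w :: rest').getLast (List.cons_ne_nil _ _) := List.getLast_cons (List.cons_ne_nil _ _)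
          rw [← this]; exact hlast
        · simpa using hlen

end DFS

/-- The tail of the support of a walk follows any neighbour lists containing the graph's
adjacency. [folklore] -/
theorem follows_support_tail {V : Type*} [DecidableEq V] {G : SimpleGraph V} (nbr : V → List V)
    (hnbr : ∀ a b, G.Adj a b → b ∈ nbr a) {u v : V} (p : G.Walk u v) :
    Follows nbr u p.support.tail := by
  induction p with
  | nil => simp [Follows]
  | cons h q ih =>
    rw [SimpleGraph.Walk.support_cons, List.tail_cons, ← q.cons_tail_support]
    exact ⟨hnbr _ _ h, ih⟩

end Summit.CriticalPhenomena.SAWScalingLimit.Theorems.EdgeOfPositivity.Negative
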